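import Summits.Ventures.LatticeQCDFlow.Scaling.SwapAcceptanceOptimum

/-!
HONEST FRAMING: exact (Metropolis-corrected) sampling algorithms for lattice gauge theory; figures
of merit are autocorrelation/cost numbers at stated couplings and volumes; no continuum-physics
claim.

# SwapLadderRoundTripSpacing — THE EXACT MODEL ROUND TRIP `K(K+1)/A` OF A UNIFORM LADDER AS A FUNCTION
# OF THE SPACING: IT IS STRICTLY INCREASING ABOVE GEN-4's `ℓ⋆` (SO THE FINITE-LADDER OPTIMUM ACCEPTS WITH
# PROBABILITY `≥ a⋆ ≈ 0.234`), AND THE CARD'S `20 %` SPACING COSTS AT MOST THE FACTOR `(1 + ℓ₂₀/Λ)/0.92`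
# AGAINST EVERY SPACING (row 22 `su3-ptbc`, GEN-5, ours; sequel of `SwapAcceptanceOptimum` and of
# `SwapLadderRoundTrip(Optimum)`)

Venture `LatticeQCDFlow` (cell pub-lqcd), topic `Scaling`; FANOUT row 22 (`su3-ptbc`, PTBC comparator arm
E4).  NEW WORK of the cell = elementary calculus over GEN-4's `SwapSpacingOptimum` / `SwapAcceptanceOptimum`
(`swapEff`, `strictAntiOn_swapEff`, `swapESJD`, `ladderCost`, `optSpacing`, `uTwenty`, `swapESJD_le`,
`swapESJD_twenty_gt`).  Nothing is cited as a fact.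

GEN-4 minimised the continuum PROXY `ladderCost Λ ℓ = (Λ/ℓ)²/erfc(ℓ/(2√2)) = Λ²/ESJD(ℓ)` (optimal spacing
`ℓ⋆ = optSpacing`, universal acceptance `a⋆`); GEN-5's `SwapLadderRoundTrip` / `…Optimum` showed the EXACT
model round trip of the uniform `K`-interval ladder is `2K(K+1)/erfc(ℓ/(2√2))`, `K = Λ/ℓ`.  This file studies
the exact quantity `uniformRT Λ ℓ = (Λ/ℓ)(Λ/ℓ + 1)/erfc(ℓ/(2√2)) = (Λ² + Λℓ)/ESJD(ℓ)` (half the round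
trip; `K` real-relaxed) as a function of the spacing:

* `uniformRT_eq_ladderCost_add` — `uniformRT = ladderCost + (Λ/ℓ)/erfc(ℓ/(2√2))` (proxy + finite-ladder
  term); `uniformRT_intervals` — at `ℓ = Λ/K` it is `K(K+1)/erfc((Λ/K)/(2√2))` (dock to
  `SwapLadderRoundTripOptimum.model_round_trip_uniformLadder`); `ladderCost_le_uniformRT`;
* `strictAntiOn_swapESJD` (`ESJD` strictly decreasing on `[ℓ⋆, ∞)`); **`strictMonoOn_uniformRT`** —
  for `Λ > 0` the exact round trip is STRICTLY INCREASING on `[ℓ⋆, ∞)`: every spacing above `ℓ⋆` is beaten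
  by `ℓ⋆` (`uniformRT_optSpacing_lt`), so the finite-ladder optimum spacing is `≤ ℓ⋆` and its acceptance is
  `≥ a⋆` (`> 0.2334`, `SwapAcceptanceOptimumSharp`) — the finite-`K` correction moves the model optimum
  FURTHER from `0.20`, not towards it; in particular **`uniformRT_optSpacing_lt_twenty`**: re-tuning from
  the card's `20 %` (`ℓ₂₀ = twentySpacing > ℓ⋆`) to `a⋆` strictly shortens the exact model round trip;
* **`uniformRT_twenty_lt`** — but by little: for EVERY spacing `ℓ > 0` (the unknown exact optimum included)
  `uniformRT Λ ℓ₂₀ < ((1 + ℓ₂₀/Λ)/0.92)·uniformRT Λ ℓ`, with `ℓ₂₀ < 2√2` (`twentySpacing_lt`);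
  **`uniformRT_twenty_lt_of_ten_intervals`** — once the `20 %` ladder has at least ten intervals
  (`Λ ≥ 10ℓ₂₀`) its exact model round trip is within `20 %` of the best uniform ladder with ANY number of
  replicas.

Reading for CARD-su3-ptbc §1.5 (`swap_acc_target = 0.20`): GEN-4's conclusion ('`0.20` keeps `≥ 92 %` of
the optimal ESJD; no lever change') survives the finite-ladder correction: the exact model optimum lies at
acceptance `≥ a⋆`, and the `20 %` rule's round-trip penalty is `< (1 + ℓ₂₀/Λ)/0.92`.  NOT CLAIMED:
existence/uniqueness of the exact optimum spacing (only that it cannot exceed `ℓ⋆`); integrality of `K`;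
that the model describes PTBC at the card's points; any number of a run.
-/

noncomputable section

open Real Set
open Literature.ComputerArithmetic.BrentZimmermann2010.AsymptoticExpansions (erfc erfc_pos)

namespace Summit.Ventures.LatticeQCDFlow.Scaling

/-! ## §1 The exact uniform round trip as a function of the spacing -/

section Exact

/-- **Half the exact model round trip of the uniform ladder** of total stiffness `Λ` and spacing `ℓ`
(`K = Λ/ℓ` intervals, real-relaxed): `K(K+1)/erfc(ℓ/(2√2))`. [ours] -/
def uniformRT (Λ ℓ : ℝ) : ℝ := Λ / ℓ * (Λ / ℓ + 1) / erfc (ℓ / (2 * sqrt 2))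

/-- `uniformRT = ladderCost + (Λ/ℓ)/erfc(ℓ/(2√2))`: GEN-4's proxy plus the finite-ladder term. [ours] -/
theorem uniformRT_eq_ladderCost_add (Λ ℓ : ℝ) :
    uniformRT Λ ℓ = ladderCost Λ ℓ + Λ / ℓ / erfc (ℓ / (2 * sqrt 2)) := by
  unfold uniformRT ladderCost
  ring

/-- `uniformRT Λ ℓ = (Λ² + Λℓ)/ESJD(ℓ)` for `ℓ ≠ 0`. [ours] -/
theorem uniformRT_eq_div_swapESJD (Λ : ℝ) {ℓ : ℝ} (hℓ : ℓ ≠ 0) :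
    uniformRT Λ ℓ = (Λ ^ 2 + Λ * ℓ) / swapESJD ℓ := by
  have hA : erfc (ℓ / (2 * sqrt 2)) ≠ 0 := (erfc_pos _).ne'
  unfold uniformRT swapESJD
  field_simp

/-- **Dock to the walk**: at `ℓ = Λ/K` (`K ≥ 1`, `Λ ≠ 0`) `uniformRT` is `K(K+1)/erfc((Λ/K)/(2√2))`, half of
`SwapLadderRoundTripOptimum.model_round_trip_uniformLadder`'s `2K(K+1)/gaussAcc(Λ/K)`. [ours] -/
theorem uniformRT_intervals {Λ : ℝ} (hΛ : Λ ≠ 0) {K : ℕ} (hK : 0 < K) :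
    uniformRT Λ (Λ / K) = (K : ℝ) * (K + 1) / erfc (Λ / K / (2 * sqrt 2)) := by
  have hK' : (K : ℝ) ≠ 0 := by exact_mod_cast hK.ne'
  have e : Λ / (Λ / K) = K := by field_simp
  unfold uniformRT
  rw [e]

/-- The proxy under-estimates: `ladderCost Λ ℓ ≤ uniformRT Λ ℓ` (`Λ ≥ 0`, `ℓ > 0`). [ours] -/
theorem ladderCost_le_uniformRT {Λ ℓ : ℝ} (hΛ : 0 ≤ Λ) (hℓ : 0 < ℓ) : ladderCost Λ ℓ ≤ uniformRT Λ ℓ := by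
  rw [uniformRT_eq_ladderCost_add]
  have : 0 ≤ Λ / ℓ / erfc (ℓ / (2 * sqrt 2)) := div_nonneg (div_nonneg hΛ hℓ.le) (erfc_pos _).le
  linarith

/-- `uniformRT > 0` for `Λ > 0`, `ℓ > 0`. [ours] -/
theorem uniformRT_pos {Λ ℓ : ℝ} (hΛ : 0 < Λ) (hℓ : 0 < ℓ) : 0 < uniformRT Λ ℓ := by
  unfold uniformRT
  have h1 : 0 < Λ / ℓ := div_pos hΛ hℓ
  exact div_pos (mul_pos h1 (by linarith)) (erfc_pos _)

end Exact

/-! ## §2 Above `ℓ⋆` the exact round trip increases: the finite-ladder optimum accepts with probability `≥ a⋆` -/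

section Mono

/-- **`ESJD` is strictly decreasing on `[ℓ⋆, ∞)`** (`swapEff` is on `[u⋆, ∞)`). [ours] -/
theorem strictAntiOn_swapESJD : StrictAntiOn swapESJD (Ici optSpacing) := by
  intro a ha b hb hab
  rw [swapESJD_eq, swapESJD_eq]
  have h2 := two_mul_sqrt_two_pos
  have ha' : uOpt ≤ a / (2 * sqrt 2) := by
    rw [← optSpacing_div]; exact div_le_div_of_nonneg_right ha h2.le
  have hb' : uOpt ≤ b / (2 * sqrt 2) := by
    rw [← optSpacing_div]; exact div_le_div_of_nonneg_right hb h2.le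
  have h := strictAntiOn_swapEff ha' hb' (div_lt_div_of_pos_right hab h2)
  linarith

/-- **THE EXACT ROUND TRIP IS STRICTLY INCREASING IN THE SPACING ON `[ℓ⋆, ∞)`** (`Λ > 0`): the numerator
`Λ² + Λℓ` increases and `ESJD(ℓ)` decreases there. [ours] -/
theorem strictMonoOn_uniformRT {Λ : ℝ} (hΛ : 0 < Λ) : StrictMonoOn (uniformRT Λ) (Ici optSpacing) := by
  intro a ha b hb hab
  have ha0 : 0 < a := lt_of_lt_of_le optSpacing_pos ha
  have hb0 : 0 < b := lt_of_lt_of_le optSpacing_pos hb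
  have hE : swapESJD b < swapESJD a := strictAntiOn_swapESJD ha hb hab
  have hEb : 0 < swapESJD b := swapESJD_pos hb0
  rw [uniformRT_eq_div_swapESJD Λ ha0.ne', uniformRT_eq_div_swapESJD Λ hb0.ne']
  have hnum : Λ ^ 2 + Λ * a < Λ ^ 2 + Λ * b := by nlinarith
  have hnb : 0 ≤ Λ ^ 2 + Λ * b := by positivity
  calc (Λ ^ 2 + Λ * a) / swapESJD a < (Λ ^ 2 + Λ * b) / swapESJD a :=
        div_lt_div_of_pos_right hnum (swapESJD_pos ha0)
    _ ≤ (Λ ^ 2 + Λ * b) / swapESJD b := div_le_div_of_nonneg_left hnb hEb hE.le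

/-- **Every spacing above `ℓ⋆` is beaten by `ℓ⋆`**: the exact finite-ladder optimum spacing (if any) is
`≤ ℓ⋆`, i.e. its acceptance is `≥ a⋆` (`> 0.2334` by `SwapAcceptanceOptimumSharp`) — the finite-`K`
correction moves the model optimum AWAY from `0.20`. [ours] -/
theorem uniformRT_optSpacing_lt {Λ ℓ : ℝ} (hΛ : 0 < Λ) (hℓ : optSpacing < ℓ) :
    uniformRT Λ optSpacing < uniformRT Λ ℓ :=
  strictMonoOn_uniformRT hΛ (self_mem_Ici) (mem_Ici.mpr hℓ.le) hℓ

/-- **The card's `20 %` spacing** `ℓ₂₀ = 2√2·u₂₀` (every pair accepts with probability `1/5`). [ours] -/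
def twentySpacing : ℝ := 2 * sqrt 2 * uTwenty

/-- `ℓ₂₀/(2√2) = u₂₀`. [ours] -/
theorem twentySpacing_div : twentySpacing / (2 * sqrt 2) = uTwenty := by
  rw [twentySpacing, mul_div_cancel_left₀ _ two_mul_sqrt_two_pos.ne']

/-- `erfc(ℓ₂₀/(2√2)) = 1/5`. [ours] -/
theorem erfc_twentySpacing : erfc (twentySpacing / (2 * sqrt 2)) = 1 / 5 := by
  rw [twentySpacing_div, erfc_uTwenty]

/-- `ℓ₂₀ > 0`. [ours] -/
theorem twentySpacing_pos : 0 < twentySpacing :=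
  mul_pos two_mul_sqrt_two_pos (by linarith [uTwenty_mem_Ioo.1])

/-- `ℓ₂₀ < 2√2` (`u₂₀ < 1`). [ours] -/
theorem twentySpacing_lt : twentySpacing < 2 * sqrt 2 := by
  have h := uTwenty_mem_Ioo.2
  have h2 := two_mul_sqrt_two_pos
  calc twentySpacing = 2 * sqrt 2 * uTwenty := rfl
    _ < 2 * sqrt 2 * 1 := mul_lt_mul_of_pos_left h h2
    _ = 2 * sqrt 2 := mul_one _

/-- `ℓ⋆ < ℓ₂₀` (`u⋆ < u₂₀`): the `20 %` ladder is more widely spaced than GEN-4's proxy optimum. [ours] -/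
theorem optSpacing_lt_twentySpacing : optSpacing < twentySpacing :=
  mul_lt_mul_of_pos_left uOpt_lt_uTwenty two_mul_sqrt_two_pos

/-- **Re-tuning from `20 %` to `a⋆` strictly shortens the exact model round trip** (`Λ > 0`, endpoints
fixed). [ours] -/
theorem uniformRT_optSpacing_lt_twenty {Λ : ℝ} (hΛ : 0 < Λ) :
    uniformRT Λ optSpacing < uniformRT Λ twentySpacing :=
  uniformRT_optSpacing_lt hΛ optSpacing_lt_twentySpacing

end Mono

/-! ## §3 … but by little: the `20 %` rule costs at most the factor `(1 + ℓ₂₀/Λ)/0.92` against every spacing -/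

section Twenty

/-- At the `20 %` spacing the finite-ladder term is the fraction `ℓ₂₀/Λ` of the proxy:
`uniformRT Λ ℓ₂₀ = (1 + ℓ₂₀/Λ)·ladderCost Λ ℓ₂₀` (`Λ ≠ 0`). [ours] -/
theorem uniformRT_twenty_eq {Λ : ℝ} (hΛ : Λ ≠ 0) :
    uniformRT Λ twentySpacing = (1 + twentySpacing / Λ) * ladderCost Λ twentySpacing := by
  have hℓ : twentySpacing ≠ 0 := twentySpacing_pos.ne'
  unfold uniformRT ladderCost
  rw [erfc_twentySpacing]
  field_simp

/-- The proxy at `ℓ₂₀` is within `1/0.92` of the proxy optimum: `ladderCost Λ ℓ₂₀ < ladderCost Λ ℓ⋆/0.92`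
(`Λ ≠ 0`; `ESJD(ℓ₂₀) > 0.92·ESJD(ℓ⋆)`). [ours] -/
theorem ladderCost_twenty_lt {Λ : ℝ} (hΛ : Λ ≠ 0) :
    ladderCost Λ twentySpacing < ladderCost Λ optSpacing / 0.92 := by
  rw [ladderCost_eq, ladderCost_eq]
  have h := swapESJD_twenty_gt
  have hE20 : 0 < swapESJD twentySpacing := swapESJD_pos twentySpacing_pos
  have hEopt : 0 < swapESJD optSpacing := swapESJD_pos optSpacing_pos
  have hΛ2 : 0 < Λ ^ 2 := by positivity
  rw [div_div, lt_div_iff₀ (by positivity), div_mul_eq_mul_div, div_lt_iff₀ hE20]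
  -- `Λ² · ESJD(ℓ⋆)·0.92 < Λ² · ESJD(ℓ₂₀)`
  have : swapESJD (2 * sqrt 2 * uTwenty) = swapESJD twentySpacing := rfl
  rw [this] at h
  nlinarith

/-- **THE `20 %` RULE'S EXACT ROUND-TRIP PENALTY**: for every spacing `ℓ > 0` (the exact finite-ladder
optimum included), `uniformRT Λ ℓ₂₀ < ((1 + ℓ₂₀/Λ)/0.92)·uniformRT Λ ℓ` (`Λ > 0`). [ours] -/
theorem uniformRT_twenty_lt {Λ ℓ : ℝ} (hΛ : 0 < Λ) (hℓ : 0 < ℓ) :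
    uniformRT Λ twentySpacing < (1 + twentySpacing / Λ) / 0.92 * uniformRT Λ ℓ := by
  have hfac : 0 < 1 + twentySpacing / Λ := by
    have := div_pos twentySpacing_pos hΛ; linarith
  have h1 := uniformRT_twenty_eq hΛ.ne'
  have h2 := ladderCost_twenty_lt hΛ.ne'
  have h3 : ladderCost Λ optSpacing ≤ ladderCost Λ ℓ := ladderCost_opt_le Λ hℓ
  have h4 : ladderCost Λ ℓ ≤ uniformRT Λ ℓ := ladderCost_le_uniformRT hΛ.le hℓ
  rw [h1]
  calc (1 + twentySpacing / Λ) * ladderCost Λ twentySpacing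
        < (1 + twentySpacing / Λ) * (ladderCost Λ optSpacing / 0.92) := mul_lt_mul_of_pos_left h2 hfac
    _ ≤ (1 + twentySpacing / Λ) * (uniformRT Λ ℓ / 0.92) := by
        apply mul_le_mul_of_nonneg_left _ hfac.le
        exact div_le_div_of_nonneg_right (h3.trans h4) (by norm_num)
    _ = (1 + twentySpacing / Λ) / 0.92 * uniformRT Λ ℓ := by ring

/-- **With at least ten intervals at `20 %` (`Λ ≥ 10ℓ₂₀`) the `20 %` ladder's exact model round trip is
within `20 %` of the best uniform ladder with ANY number of replicas** (`1.1/0.92 < 1.2`). [ours] -/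
theorem uniformRT_twenty_lt_of_ten_intervals {Λ ℓ : ℝ} (hΛ : 10 * twentySpacing ≤ Λ) (hℓ : 0 < ℓ) :
    uniformRT Λ twentySpacing < 1.2 * uniformRT Λ ℓ := by
  have hΛpos : 0 < Λ := lt_of_lt_of_le (by linarith [twentySpacing_pos]) hΛ
  have h1 := uniformRT_twenty_lt hΛpos hℓ
  have hfrac : twentySpacing / Λ ≤ 1 / 10 := by
    rw [div_le_iff₀ hΛpos]; linarith
  have hR : 0 < uniformRT Λ ℓ := uniformRT_pos hΛpos hℓ
  have h2 : (1 + twentySpacing / Λ) / 0.92 * uniformRT Λ ℓ ≤ 1.2 * uniformRT Λ ℓ := by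
    apply mul_le_mul_of_nonneg_right _ hR.le
    rw [div_le_iff₀ (by norm_num)]
    linarith
  exact h1.trans_le h2

end Twenty

end Summit.Ventures.LatticeQCDFlow.Scaling

end
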